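import Summits.QuantumFields.YangMills.Theorems.BalabanUVNodesN15TwoGridDressedJetNoFitC
import HarnessLib

/-!
# N15 (NE2) — PROGRAMME M-III, part III-C: ★★★ THE CARRIER-GENERIC EDITION OF III-B — the η-defect of the whole first-order dressed jet on ANY [B6] carrier `g` with blocks `blk`,
# pairing `π`, ABSTRACT derived pieces `D_μ, D′_μ`, the `c′`-defect sandwiched as two rows — so that SCALAR model rungs (dag-n15-d∕-e's King propagator) plug in with one `exact`

WHO ∕ WHEN.  Cell `pub-ymgap`, seat `pub-ymgap-dag-n15-a` (KNIT-BY-NAME seat of Track-A DAG node N15 = NE2, g24); `--kind proof --supports stmt-QuantumFields-27366 --as helper` (K3⁸;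
count-neutral).  THEOREMS ONLY (0 `def`).  Over III-B `…TwoGridDressedJetNoFitC` (★★ `hasMaj_idef_bgPropV_of_sandwich`, `stack_comp`, `idef_unstack_eq`), II-B (`hasMaj_comp_diagK_const`,
`diagK_const_mono`), n15-b B1∕B1b (`hasMaj_bgPropV`, `stack`, `unstack`, `projO`, `liftPair`, `blkPair`, `bgPair`, `idef_stack`, `hasMaj_stack`, `hasMaj_unstack`, `hasMaj_projO_comp`,
`abs_blockAvg_le`), `T4EtaRateCoeffDefect.hasMaj_idef_mulOp`, `B11SectG.hasMaj_comp_exp`, part 3 `hasMaj_finsum` BY NAME; nothing in the tree is modified.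

WHY (dag-n15-d g20 I.42062 «which g», this seat's «ROW (go)» I.≈42090).  III-B is stated on King's 1-form torus carriers `Tor (fine n M) × Fin (d+1)` with the difference symbols
`symbOp sD`; the King-model rung is SCALAR (`Tor (fine N M)`, its own `kingDOp`).  Nothing in III-B's proof uses the torus or the symbols: the derived pieces are abstract letters.  This file
states the theorem once in n15-b B1b's generality (`hasMaj_idef_bgPair` with the fit letter of `c′` REPLACED by the two sandwiched rows): fine blocks `blk ∘ π`, `R ≥ r(1 + |J|)`.

WHAT.  §28 ★★★ `hasMaj_idef_bgPair_of_sandwichRows_generic`, ★★ `hasMaj_projO_idef_bgPair_generic` (components; the dressed gradient entry `j = some ν`).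

HONEST FRAMING ∕ LIMITS.  Block-majorant bookkeeping over hypothesis-shaped rows; abelianised scalar-multiplier MODEL of (3.52)'s `V′(A)`, block-averaged coarse partner (C3); no estimate of
[B5]∕[B6]∕[B9]∕[King1986] asserted; NE2⁺ NOT printed ∕ proved; no statement of record touched; N15 NOT discharged; K3⁸ OPEN; counts UNMOVED (typed 28∕28 · discharged 5∕27);
NOT infinite volume ∕ OS ∕ mass gap ∕ Clay.
-/

noncomputable section

open scoped BigOperators
open Finset

namespace Summit.QuantumFields.YangMills.BalabanUVNodes.N15.TwoGrid

open Literature.MathematicalPhysics.QuantumFieldTheory.Balaban1983to89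
open Literature.MathematicalPhysics.QuantumFieldTheory.Balaban1983to89.B11SectG (BlockNorm HasMaj hasMaj_comp hasMaj_comp_exp RowSum)
open Literature.MathematicalPhysics.QuantumFieldTheory.Balaban1983to89.T4EtaRateDefect (idef)
open Literature.MathematicalPhysics.QuantumFieldTheory.Balaban1983to89.T4EtaRateCoeffDefect (pull pull_apply diagK blockAvg hasMaj_idef_mulOp)
open Literature.MathematicalPhysics.QuantumFieldTheory.Balaban1983to89.B6RandomWalk (Triangle254)
open Literature.MathematicalPhysics.QuantumFieldTheory.Balaban1983to89.B6Prop26Gluing (mulOp mulOp_apply)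
open Summit.QuantumFields.YangMills.BalabanUVNodes.N15.BackgroundModel (kappa_ofBlocks)
open Summit.QuantumFields.YangMills.BalabanUVNodes.N15.BackgroundLayer (bgPropV hasMaj_bgPropV stack unstack projO liftPair blkPair bgPair idef_stack hasMaj_stack hasMaj_unstack
  hasMaj_projO_comp abs_blockAvg_le)

/-! ## §28 The carrier-generic edition -/

section Generic

variable {X X' J : Type} [Fintype X] [Fintype X'] [Fintype J] [DecidableEq X] [DecidableEq X'] [DecidableEq J] {g : B6.Geometry} (blk : X → g.Site) (π : X' → X)

/-- ★★★ **THE η-DEFECT OF THE WHOLE FIRST-ORDER DRESSED JET, GENERIC CARRIERS, `c′`-DEFECT SANDWICHED.**  A [B6] carrier with (2.54), `d ≥ 0`, (2.61) at `σ ≥ 0` (`c_r ≥ 0`); coarse lattice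
`X` blocked by `blk`, fine `X′` paired by `π` and blocked by `blk ∘ π`; directions `J`; `U ≡ 1` letters: coarse piece `G` and derived pieces `D_μ`, fine `G′, D′_μ`, each `≤ βe^{−δd}`, defects
`𝔇(G′, G), 𝔇(D′_μ, D_μ) ≤ m_Ge^{−δd}` through `(pull π, pull π)`; a fine first-order family `(c′, a′_μ)` with `|c′|, |a′_μ| ≤ r`, coarse partner the block averages, fit of `a′` `≤ o_a`; the
`c′`-defect SANDWICHED: `G′∘𝔇(M_{c′}, M_{c̄}) ≤ ζ₀e^{−δd}`, `D′_ν∘𝔇(M_{c′}, M_{c̄}) ≤ ζe^{−δd}`; rate `0 ≤ ρ`, `ρ + σ ≤ δ`; `R ≥ r(1 + |J|)`, `q = βRc_r < 1`, `β(1−q)⁻¹ ≤ B_X`.  CONCLUSION: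
the defect of the dressed jets `bgPair G′ D′ c′ a′`, `bgPair G D c̄ ā` through `(pull π, pull (liftPair π))` is
`≤ (m_Gc_r + m_Gc_r·Rβ(1−q)⁻¹ + (ζ₀ + |J|βo_a)B_Xc_r + (ζ + |J|βo_a)B_Xc_r)(1−q)⁻¹·e^{−ρd}` — NO fit ∕ oscillation ∕ gradient letter on `c′`.
[cite: Balaban1985BackgroundPropagators, (3.35) p.396 (letters), (3.52) p.400, (3.62)–(3.65) pp.402–403 (mechanism); Balaban1984PropagatorsII, (2.52)–(2.56) pp.232–233, Lemma 2.1 (2.61) p.234] -/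
theorem hasMaj_idef_bgPair_of_sandwichRows_generic (htri : Triangle254 g) (hd : ∀ a b : g.Site, 0 ≤ g.dist a b) {σ cr : ℝ} (hσ : 0 ≤ σ) (hcr : 0 ≤ cr) (hrow : RowSum g σ cr)
    {ρ δ β mG r oa ζ₀ ζ R BX : ℝ} (hρ : 0 ≤ ρ) (hρδ : ρ + σ ≤ δ) (hβ : 0 ≤ β) (hmG : 0 ≤ mG) (hr : 0 ≤ r) (hoa : 0 ≤ oa) (hζ₀ : 0 ≤ ζ₀) (hζ : 0 ≤ ζ)
    {G : (X → ℝ) →ₗ[ℝ] (X → ℝ)} {D : J → (X → ℝ) →ₗ[ℝ] (X → ℝ)} {G' : (X' → ℝ) →ₗ[ℝ] (X' → ℝ)} {D' : J → (X' → ℝ) →ₗ[ℝ] (X' → ℝ)}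
    {c' : X' → ℝ} {a' : J → X' → ℝ}
    (hG : HasMaj (BlockNorm.ofBlocks g blk) (BlockNorm.ofBlocks g blk) G (fun y y' => β * Real.exp (-(δ * g.dist y y'))))
    (hGD : ∀ μ, HasMaj (BlockNorm.ofBlocks g blk) (BlockNorm.ofBlocks g blk) (D μ) (fun y y' => β * Real.exp (-(δ * g.dist y y'))))
    (hG' : HasMaj (BlockNorm.ofBlocks g (blk ∘ π)) (BlockNorm.ofBlocks g (blk ∘ π)) G' (fun y y' => β * Real.exp (-(δ * g.dist y y'))))
    (hG'D : ∀ μ, HasMaj (BlockNorm.ofBlocks g (blk ∘ π)) (BlockNorm.ofBlocks g (blk ∘ π)) (D' μ) (fun y y' => β * Real.exp (-(δ * g.dist y y'))))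
    (hDG : HasMaj (BlockNorm.ofBlocks g blk) (BlockNorm.ofBlocks g (blk ∘ π)) (idef (pull π) (pull π) G' G) (fun y y' => mG * Real.exp (-(δ * g.dist y y'))))
    (hDD : ∀ μ, HasMaj (BlockNorm.ofBlocks g blk) (BlockNorm.ofBlocks g (blk ∘ π)) (idef (pull π) (pull π) (D' μ) (D μ)) (fun y y' => mG * Real.exp (-(δ * g.dist y y'))))
    (hGc : HasMaj (BlockNorm.ofBlocks g blk) (BlockNorm.ofBlocks g (blk ∘ π)) (G' ∘ₗ idef (pull π) (pull π) (mulOp c') (mulOp (blockAvg π c')))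
      (fun y y' => ζ₀ * Real.exp (-(δ * g.dist y y'))))
    (hDGc : ∀ ν, HasMaj (BlockNorm.ofBlocks g blk) (BlockNorm.ofBlocks g (blk ∘ π)) (D' ν ∘ₗ idef (pull π) (pull π) (mulOp c') (mulOp (blockAvg π c')))
      (fun y y' => ζ * Real.exp (-(δ * g.dist y y'))))
    (hc' : ∀ x', |c' x'| ≤ r) (ha' : ∀ μ x', |a' μ x'| ≤ r) (hfa : ∀ μ x', |a' μ x' - blockAvg π (a' μ) (π x')| ≤ oa)
    (hR : r * (1 + Fintype.card J) ≤ R) (hq : β * R * cr < 1) (hBX : β * (1 - β * R * cr)⁻¹ ≤ BX) :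
    HasMaj (BlockNorm.ofBlocks g blk) (BlockNorm.ofBlocks g (blkPair (blk ∘ π)))
      (idef (pull π) (pull (liftPair π)) (bgPair G' D' c' a') (bgPair G D (blockAvg π c') (fun μ => blockAvg π (a' μ))))
      (fun y y' => (mG * cr + 1 * (mG * cr) * (R * (β * (1 - β * R * cr)⁻¹)) +
          ((ζ₀ + Fintype.card J * (β * oa)) * BX * cr + (ζ + Fintype.card J * (β * oa)) * BX * cr)) * (1 - 1 * (β * R * cr))⁻¹ * Real.exp (-(ρ * g.dist y y'))) := by
  have hq0 : 0 < 1 - β * R * cr := by linarith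
  set βX : ℝ := β * (1 - β * R * cr)⁻¹ with hβX_def
  have hβX : 0 ≤ βX := mul_nonneg hβ (inv_nonneg.2 hq0.le)
  have hBX0 : 0 ≤ BX := hβX.trans hBX
  have hR0 : 0 ≤ r * (1 + Fintype.card J) := by positivity
  have hRR : 0 ≤ R := hR0.trans hR
  have hJ : (0 : ℝ) ≤ Fintype.card J := by positivity
  set c : X → ℝ := blockAvg π c' with hc_def
  set a : J → X → ℝ := fun μ => blockAvg π (a' μ) with ha_def
  have hc : ∀ x, |c x| ≤ r := abs_blockAvg_le π hr hc'
  have ha : ∀ μ x, |a μ x| ≤ r := fun μ => abs_blockAvg_le π hr (ha' μ)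
  -- stacked `U ≡ 1` layers and their defect
  have hβe : ∀ y y' : g.Site, 0 ≤ β * Real.exp (-(δ * g.dist y y')) := fun _ _ => mul_nonneg hβ (Real.exp_nonneg _)
  have hme : ∀ y y' : g.Site, 0 ≤ mG * Real.exp (-(δ * g.dist y y')) := fun _ _ => mul_nonneg hmG (Real.exp_nonneg _)
  have hSG := hasMaj_stack (g := g) blk hβe hG hGD
  have hSG' := hasMaj_stack (g := g) (blk ∘ π) hβe hG' hG'D
  have hSD : HasMaj (BlockNorm.ofBlocks g blk) (BlockNorm.ofBlocks g (blkPair (blk ∘ π))) (idef (pull π) (pull (liftPair π)) (stack G' D') (stack G D))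
      (fun y y' => mG * Real.exp (-(δ * g.dist y y'))) := by
    rw [idef_stack]
    exact hasMaj_stack (g := g) (blk ∘ π) hme hDG hDD
  -- unstacked perturbation letters
  have hV := (hasMaj_unstack (g := g) blk hr hc ha).mono fun y y' => diagK_const_mono hR y y'
  have hV' := (hasMaj_unstack (g := g) (blk ∘ π) hr hc' ha').mono fun y y' => diagK_const_mono hR y y'
  -- the coarse jet and its components
  have hXh := hasMaj_bgPropV (g := g) blk (blkPair blk) htri hd hrow hσ hρ hρδ hβ hRR hSG hV hq
  have hXv : HasMaj (BlockNorm.ofBlocks g blk) (BlockNorm.ofBlocks g blk) (projO none ∘ₗ bgPair G D c a) (fun y y' => βX * Real.exp (-(ρ * g.dist y y'))) :=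
    hasMaj_projO_comp (g := g) blk hXh none
  have hYb : ∀ μ, HasMaj (BlockNorm.ofBlocks g blk) (BlockNorm.ofBlocks g blk) (projO (some μ) ∘ₗ bgPair G D c a) (fun y y' => βX * Real.exp (-(ρ * g.dist y y'))) :=
    fun μ => hasMaj_projO_comp (g := g) blk hXh (some μ)
  -- the `a′`-part of the coefficient defect: the fit letter, diagonal
  have hfit : ∀ μ, HasMaj (BlockNorm.ofBlocks g blk) (BlockNorm.ofBlocks g (blk ∘ π)) (idef (pull π) (pull π) (mulOp (a' μ)) (mulOp (a μ))) (diagK fun _ => oa) :=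
    fun μ => hasMaj_idef_mulOp (g := g) blk π (a' := a' μ) (a := a μ) (o := fun _ => oa) (fun _ => hoa) fun z => hfa μ z
  have haG : ∀ μ, HasMaj (BlockNorm.ofBlocks g blk) (BlockNorm.ofBlocks g (blk ∘ π)) (G' ∘ₗ idef (pull π) (pull π) (mulOp (a' μ)) (mulOp (a μ)))
      (fun y y' => β * oa * Real.exp (-(δ * g.dist y y'))) := fun μ => hasMaj_comp_diagK_const (g := g) (blk ∘ π) blk hβ hG' (hfit μ)
  have haD : ∀ ν μ, HasMaj (BlockNorm.ofBlocks g blk) (BlockNorm.ofBlocks g (blk ∘ π)) (D' ν ∘ₗ idef (pull π) (pull π) (mulOp (a' μ)) (mulOp (a μ)))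
      (fun y y' => β * oa * Real.exp (-(δ * g.dist y y'))) := fun ν μ => hasMaj_comp_diagK_const (g := g) (blk ∘ π) blk hβ (hG'D ν) (hfit μ)
  -- the two fronts composed with the jet, at the rate `ρ`
  set W := idef (pull π) (pull π) (mulOp c') (mulOp c) ∘ₗ (projO none ∘ₗ bgPair G D c a) +
      ∑ μ, idef (pull π) (pull π) (mulOp (a' μ)) (mulOp (a μ)) ∘ₗ (projO (some μ) ∘ₗ bgPair G D c a) with hW_def
  have hfront : ∀ {Tf : (X' → ℝ) →ₗ[ℝ] (X' → ℝ)} {ζf : ℝ}, 0 ≤ ζf →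
      HasMaj (BlockNorm.ofBlocks g (blk ∘ π)) (BlockNorm.ofBlocks g (blk ∘ π)) Tf (fun y y' => β * Real.exp (-(δ * g.dist y y'))) →
      HasMaj (BlockNorm.ofBlocks g blk) (BlockNorm.ofBlocks g (blk ∘ π)) (Tf ∘ₗ idef (pull π) (pull π) (mulOp c') (mulOp c)) (fun y y' => ζf * Real.exp (-(δ * g.dist y y'))) →
      HasMaj (BlockNorm.ofBlocks g blk) (BlockNorm.ofBlocks g (blk ∘ π)) (Tf ∘ₗ W) (fun y y' => (ζf + Fintype.card J * (β * oa)) * βX * cr * Real.exp (-(ρ * g.dist y y'))) := by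
    intro Tf ζf hζf hTf hTc
    have haT : ∀ μ, HasMaj (BlockNorm.ofBlocks g blk) (BlockNorm.ofBlocks g (blk ∘ π)) (Tf ∘ₗ idef (pull π) (pull π) (mulOp (a' μ)) (mulOp (a μ)))
        (fun y y' => β * oa * Real.exp (-(δ * g.dist y y'))) := fun μ => hasMaj_comp_diagK_const (g := g) (blk ∘ π) blk hβ hTf (hfit μ)
    have e1 := hasMaj_comp_exp (b₁ := BlockNorm.ofBlocks g blk) (b₂ := BlockNorm.ofBlocks g blk) (b₃ := BlockNorm.ofBlocks g (blk ∘ π)) htri hd hrow hζf hβX hρ le_rfl hρδ hTc hXv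
    have e2 := hasMaj_finsum (b₁ := BlockNorm.ofBlocks g blk) (b₂ := BlockNorm.ofBlocks g (blk ∘ π)) Finset.univ
      (fun μ => (Tf ∘ₗ idef (pull π) (pull π) (mulOp (a' μ)) (mulOp (a μ))) ∘ₗ (projO (some μ) ∘ₗ bgPair G D c a))
      (fun _ y y' => (BlockNorm.ofBlocks g blk).κ * (β * oa) * βX * cr * Real.exp (-(ρ * g.dist y y')))
      fun μ _ => hasMaj_comp_exp (b₁ := BlockNorm.ofBlocks g blk) (b₂ := BlockNorm.ofBlocks g blk) (b₃ := BlockNorm.ofBlocks g (blk ∘ π)) htri hd hrow (mul_nonneg hβ hoa) hβX hρ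
        le_rfl hρδ (haT μ) (hYb μ)
    have hop : Tf ∘ₗ W = (Tf ∘ₗ idef (pull π) (pull π) (mulOp c') (mulOp c)) ∘ₗ (projO none ∘ₗ bgPair G D c a) +
        ∑ μ, (Tf ∘ₗ idef (pull π) (pull π) (mulOp (a' μ)) (mulOp (a μ))) ∘ₗ (projO (some μ) ∘ₗ bgPair G D c a) := by
      rw [hW_def]
      refine LinearMap.ext fun f => ?_
      simp only [LinearMap.comp_apply, LinearMap.add_apply, LinearMap.sum_apply, map_add, map_sum]
    rw [hop]
    refine (e1.add e2).mono fun y y' => le_of_eq ?_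
    rw [sum_const, card_univ, nsmul_eq_mul]
    simp only [kappa_ofBlocks]
    ring
  have hWG := hfront hζ₀ hG' hGc
  have hWD := fun ν => hfront hζ (hG'D ν) (hDGc ν)
  -- stack the fronts: binder (d) sandwiched
  have hcG1 : 0 ≤ (ζ₀ + Fintype.card J * (β * oa)) * BX * cr := by positivity
  have hcD1 : 0 ≤ (ζ + Fintype.card J * (β * oa)) * BX * cr := by positivity
  have hW : idef (pull (liftPair (J := J) π)) (pull π) (unstack c' a') (unstack c a) ∘ₗ bgPropV (stack G D) (unstack c a) = W := by
    rw [hW_def, idef_unstack_eq]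
    refine LinearMap.ext fun f => ?_
    simp only [LinearMap.comp_apply, LinearMap.add_apply, LinearMap.sum_apply, bgPair]
  have hmono : ∀ {T : (X → ℝ) →ₗ[ℝ] (X' → ℝ)} {ζf : ℝ}, 0 ≤ ζf →
      HasMaj (BlockNorm.ofBlocks g blk) (BlockNorm.ofBlocks g (blk ∘ π)) T (fun y y' => (ζf + Fintype.card J * (β * oa)) * βX * cr * Real.exp (-(ρ * g.dist y y'))) →
      (ζf + Fintype.card J * (β * oa)) * BX * cr ≤ (ζ₀ + Fintype.card J * (β * oa)) * BX * cr + (ζ + Fintype.card J * (β * oa)) * BX * cr →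
      HasMaj (BlockNorm.ofBlocks g blk) (BlockNorm.ofBlocks g (blk ∘ π)) T
        (fun y y' => ((ζ₀ + Fintype.card J * (β * oa)) * BX * cr + (ζ + Fintype.card J * (β * oa)) * BX * cr) * Real.exp (-(ρ * g.dist y y'))) := by
    intro T ζf hζf h hle
    refine h.mono fun y y' => ?_
    have hE := Real.exp_nonneg (-(ρ * g.dist y y'))
    have h1 : (ζf + Fintype.card J * (β * oa)) * βX * cr ≤ (ζf + Fintype.card J * (β * oa)) * BX * cr :=
      mul_le_mul_of_nonneg_right (mul_le_mul_of_nonneg_left hBX (by positivity)) hcr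
    exact mul_le_mul_of_nonneg_right (h1.trans hle) hE
  have hst : stack G' D' ∘ₗ idef (pull (liftPair (J := J) π)) (pull π) (unstack c' a') (unstack c a) ∘ₗ bgPropV (stack G D) (unstack c a) =
      stack (G' ∘ₗ W) (fun ν => D' ν ∘ₗ W) := by
    rw [hW, stack_comp]
  have hDVs : HasMaj (BlockNorm.ofBlocks g blk) (BlockNorm.ofBlocks g (blkPair (blk ∘ π)))
      (stack G' D' ∘ₗ idef (pull (liftPair (J := J) π)) (pull π) (unstack c' a') (unstack c a) ∘ₗ bgPropV (stack G D) (unstack c a))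
      (fun y y' => ((ζ₀ + Fintype.card J * (β * oa)) * BX * cr + (ζ + Fintype.card J * (β * oa)) * BX * cr) * Real.exp (-(ρ * g.dist y y'))) := by
    rw [hst]
    exact hasMaj_stack (g := g) (blk ∘ π) (fun _ _ => mul_nonneg (add_nonneg hcG1 hcD1) (Real.exp_nonneg _)) (hmono hζ₀ hWG (le_add_of_nonneg_right hcD1))
      fun ν => hmono hζ (hWD ν) (le_add_of_nonneg_left hcG1)
  -- n15-b's device, sandwiched edition (III-B §26)
  exact hasMaj_idef_bgPropV_of_sandwich (g := g) blk (blkPair blk) π (liftPair (J := J) π) htri hd hσ hrow hρ hρδ hβ hRR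
    (cV := (ζ₀ + Fintype.card J * (β * oa)) * BX * cr + (ζ + Fintype.card J * (β * oa)) * BX * cr) (by positivity) hmG
    (G := stack G D) (V := unstack c a) (G' := stack G' D') (V' := unstack c' a') hSG hSG' hSD hV hV' hDVs hq

omit [DecidableEq X] [DecidableEq X'] [DecidableEq J] in
/-- ★★ **EACH COMPONENT — in particular the dressed GRADIENT entry `𝔇(D′_νX′, Y_ν)` (`j = some ν`) — inherits the jet's majorant** (generic carriers).
[cite: Balaban1985BackgroundPropagators, Thm 3.1 (3.42) p.397 (entries 0 and 1: shape)] -/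
theorem hasMaj_projO_idef_bgPair_generic {K : g.Site → g.Site → ℝ} {Xh' : (X' → ℝ) →ₗ[ℝ] (X' × Option J → ℝ)} {Xh : (X → ℝ) →ₗ[ℝ] (X × Option J → ℝ)}
    (h : HasMaj (BlockNorm.ofBlocks g blk) (BlockNorm.ofBlocks g (blkPair (blk ∘ π))) (idef (pull π) (pull (liftPair (J := J) π)) Xh' Xh) K) (j : Option J) :
    HasMaj (BlockNorm.ofBlocks g blk) (BlockNorm.ofBlocks g (blk ∘ π)) (idef (pull π) (pull π) (projO j ∘ₗ Xh') (projO j ∘ₗ Xh)) K := by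
  have hcomp : idef (pull π) (pull π) (projO j ∘ₗ Xh') (projO j ∘ₗ Xh) = projO j ∘ₗ idef (pull π) (pull (liftPair (J := J) π)) Xh' Xh :=
    LinearMap.ext fun v => funext fun x' => rfl
  rw [hcomp]
  exact hasMaj_projO_comp (g := g) (blk ∘ π) h j

end Generic

end Summit.QuantumFields.YangMills.BalabanUVNodes.N15.TwoGrid

end
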